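import Mathlib
import HarnessLib
import Summits.Ventures.LatticeQCDFlow.Scoring.SplitChainTourFourthMoment

/-!
# Tours of the split chain, X: SQUARED tour sums of different tours are uncorrelated —
# `E[(S^{h₁}_i)² · (S^{h₂}_{j+1})²] = E[(S^{h₁}_i)²] · E_ν̂[(S^{h₂}_0)²]` for `i ≤ j`, any start

HONEST FRAMING: exact (Metropolis-corrected) sampling algorithms for lattice gauge theory;
figures of merit are autocorrelation/cost numbers at stated couplings and volumes; no
continuum-physics claim.

Venture `LatticeQCDFlow` (cell pub-lqcd), topic `Scoring`; FANOUT row 8 (`s0-cpn-nemc`, GEN-17).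
NEW WORK of the cell, not a published result; no definition is introduced.  Notation of
`Scoring/SplitChainTours.lean`; `S^h_i = ∑' u, 1{K_u = i} h(X_u)`.  `Scoring/RegenerativeTourCovariance.lean`
(GEN-16) factorised the cross moment `E[S^{h₁}_i · S^{h₂}_{j+1}]` by the random-time regeneration
theorem at the start of tour `j + 1`, with the unbounded past weight `S^{h₁}_i` (bounded by
`C₁ (t + 1)` on `{τ_{j+1} = t + 1}`).  Here the same argument one degree up, for the regenerative
VARIANCE estimator (whose summands are SQUARED centred tour sums): the past weight is `(S^{h₁}_i)²`
(bounded by `C₁² (t+1)²` on `{τ_{j+1} = t+1}`, its weights summable because `N_i²` is integrable from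
any start), the future functional is `(S^{h₂}_0)²` (integrable under the fresh split chain), hence
`E[(S^{h₁}_i)² (S^{h₂}_{j+1})²] = E[(S^{h₁}_i)²] · E_ν̂[(S^{h₂}_0)²]` from ANY initial law — squared
(centred) tour sums, and squared tour lengths, of different tours are uncorrelated.  Printed
counterpart NAMED ONLY: independence of the tours of a split chain (Athreya–Ney 1978; Nummelin 1978;
Mykland–Tierney–Yu 1995 §2) — here in the fourth-moment form the variance estimator needs; nothing
is cited as a fact.

## Content (`0 < ε < 1`, any initial law; `h, h₁, h₂` bounded measurable)

* **`splitChain_integrable_sq_tourSum`** — every `(S^h_i)²` is integrable (so is `N_i²`);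
* **`splitChain_tour_crossMoment_sq`** — for `i ≤ j`: `(S^{h₁}_i)² (S^{h₂}_{j+1})²` is integrable and
  `E[(S^{h₁}_i)² (S^{h₂}_{j+1})²] = E[(S^{h₁}_i)²] · E_{P̂_ν̂}[(S^{h₂}_0)²]`.

NOT CLAIMED: full independence of the tour σ-fields; any `ε` of a concrete sampler.
-/

noncomputable section

namespace Summit.Ventures.LatticeQCDFlow.Scoring

open MeasureTheory ProbabilityTheory Filter Finset Preorder Literature.Probability.MarkovChains
open scoped ENNReal

section Covariance

variable {Ω : Type*} [MeasurableSpace Ω]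
  {κ : Kernel Ω Ω} [IsMarkovKernel κ] {ν : Measure Ω} [IsProbabilityMeasure ν] {ε : ℝ≥0∞}
  {hmin : ∀ x {B : Set Ω}, MeasurableSet B → ε * ν B ≤ κ x B}
  (κs : Kernel (Ω × Bool) (Ω × Bool)) [IsMarkovKernel κs]
  (μs : Measure (Ω × Bool)) [IsProbabilityMeasure μs]

/-- **Every squared tour sum is integrable** (`0 < ε < 1`, any initial law, `|h| ≤ C` measurable). -/
theorem splitChain_integrable_sq_tourSum (hε0 : 0 < ε) (hε : ε < 1)
    (hκs : ∀ p, κs p = (ε • ν).map (fun y : Ω => (y, true))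
      + ((1 - ε) • Doeblin.residualKernel κ ν ε hmin p.1).map (fun y : Ω => (y, false)))
    {h : Ω → ℝ} (hh : Measurable h) {C : ℝ} (hC : ∀ y, |h y| ≤ C) (i : ℕ) :
    Integrable (fun x : ℕ → Ω × Bool => (∑' u, (if (∑ s ∈ Finset.range u,
        (if (x (s + 1)).2 then (1 : ℕ) else 0)) = i then (1 : ℝ) else 0) * h (x u).1) ^ 2)
      (Kernel.trajMeasure (X := fun _ : ℕ => Ω × Bool) μs
        (fun n : ℕ => κs.comap (fun h : (i : ↥(Finset.Iic n)) → Ω × Bool =>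
          h ⟨n, Finset.mem_Iic.2 le_rfl⟩) (measurable_pi_apply _))) := by
  have hψ : Measurable fun pq : (Ω × Bool) × (Ω × Bool) => h pq.1.1 :=
    hh.comp (measurable_fst.comp measurable_fst)
  rcases i with _ | j
  · exact (splitChain_fresh_sq_tourSum_le κs μs (κ := κ) (ν := ν) (hmin := hmin) hε0 hε hκs hh hC).1
  · haveI hνt : IsProbabilityMeasure (ν.map (fun y : Ω => (y, true))) :=
      Measure.isProbabilityMeasure_map (measurable_tagCoin true).aemeasurable
    have h0 := (splitChain_fresh_sq_tourSum_le κs (ν.map (fun y : Ω => (y, true))) (κ := κ) (ν := ν)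
      (hmin := hmin) hε0 hε hκs hh hC).1
    exact splitChain_tourFunctional_integrable κs μs (κ := κ) (ν := ν) (hmin := hmin) hε hκs j
      (ψ₁ := fun p _ => h p.1) (ψ₂ := fun p _ => h p.1) hψ hψ (Λ := fun a _ => a ^ 2) (by norm_num)
      ((measurable_fst (α := ℝ) (β := ℝ)).pow_const 2) h0

/-- **CROSS MOMENTS OF SQUARES FACTORISE**: `0 < ε < 1`, any initial law, `h₁, h₂` bounded
measurable, `i ≤ j`.  Then `(S^{h₁}_i)² · (S^{h₂}_{j+1})²` is integrable and
`E[(S^{h₁}_i)² · (S^{h₂}_{j+1})²] = E[(S^{h₁}_i)²] · E_{P̂_ν̂}[(S^{h₂}_0)²]`. -/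
theorem splitChain_tour_crossMoment_sq (hε0 : 0 < ε) (hε : ε < 1)
    (hκs : ∀ p, κs p = (ε • ν).map (fun y : Ω => (y, true))
      + ((1 - ε) • Doeblin.residualKernel κ ν ε hmin p.1).map (fun y : Ω => (y, false)))
    {h₁ h₂ : Ω → ℝ} (hh₁ : Measurable h₁) (hh₂ : Measurable h₂) {C₁ C₂ : ℝ}
    (hC₁ : ∀ y, |h₁ y| ≤ C₁) (hC₂ : ∀ y, |h₂ y| ≤ C₂) {i j : ℕ} (hij : i ≤ j) :
    Integrable (fun x : ℕ → Ω × Bool =>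
        (∑' u, (if (∑ s ∈ Finset.range u, (if (x (s + 1)).2 then (1 : ℕ) else 0)) = i
          then (1 : ℝ) else 0) * h₁ (x u).1) ^ 2
        * (∑' u, (if (∑ s ∈ Finset.range u, (if (x (s + 1)).2 then (1 : ℕ) else 0)) = j + 1
          then (1 : ℝ) else 0) * h₂ (x u).1) ^ 2)
      (Kernel.trajMeasure (X := fun _ : ℕ => Ω × Bool) μs
        (fun n : ℕ => κs.comap (fun h : (i : ↥(Finset.Iic n)) → Ω × Bool =>
          h ⟨n, Finset.mem_Iic.2 le_rfl⟩) (measurable_pi_apply _)))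
    ∧ ∫ x, (∑' u, (if (∑ s ∈ Finset.range u, (if (x (s + 1)).2 then (1 : ℕ) else 0)) = i
          then (1 : ℝ) else 0) * h₁ (x u).1) ^ 2
        * (∑' u, (if (∑ s ∈ Finset.range u, (if (x (s + 1)).2 then (1 : ℕ) else 0)) = j + 1
          then (1 : ℝ) else 0) * h₂ (x u).1) ^ 2
        ∂(Kernel.trajMeasure (X := fun _ : ℕ => Ω × Bool) μs
          (fun n : ℕ => κs.comap (fun h : (i : ↥(Finset.Iic n)) → Ω × Bool =>
            h ⟨n, Finset.mem_Iic.2 le_rfl⟩) (measurable_pi_apply _)))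
      = (∫ x, (∑' u, (if (∑ s ∈ Finset.range u, (if (x (s + 1)).2 then (1 : ℕ) else 0)) = i
          then (1 : ℝ) else 0) * h₁ (x u).1) ^ 2
          ∂(Kernel.trajMeasure (X := fun _ : ℕ => Ω × Bool) μs
            (fun n : ℕ => κs.comap (fun h : (i : ↥(Finset.Iic n)) → Ω × Bool =>
              h ⟨n, Finset.mem_Iic.2 le_rfl⟩) (measurable_pi_apply _))))
        * ∫ y, (∑' u, (if (∑ s ∈ Finset.range u, (if (y (s + 1)).2 then (1 : ℕ) else 0)) = 0
          then (1 : ℝ) else 0) * h₂ (y u).1) ^ 2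
          ∂(Kernel.trajMeasure (X := fun _ : ℕ => Ω × Bool) (ν.map (fun y : Ω => (y, true)))
            (fun n : ℕ => κs.comap (fun h : (i : ↥(Finset.Iic n)) → Ω × Bool =>
              h ⟨n, Finset.mem_Iic.2 le_rfl⟩) (measurable_pi_apply _))) := by
  haveI hνt : IsProbabilityMeasure (ν.map (fun y : Ω => (y, true))) :=
    Measure.isProbabilityMeasure_map (measurable_tagCoin true).aemeasurable
  set P := Kernel.trajMeasure (X := fun _ : ℕ => Ω × Bool) μs
      (fun n : ℕ => κs.comap (fun h : (i : ↥(Finset.Iic n)) → Ω × Bool =>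
        h ⟨n, Finset.mem_Iic.2 le_rfl⟩) (measurable_pi_apply _)) with hP
  set Pν := Kernel.trajMeasure (X := fun _ : ℕ => Ω × Bool) (ν.map (fun y : Ω => (y, true)))
      (fun n : ℕ => κs.comap (fun h : (i : ↥(Finset.Iic n)) → Ω × Bool =>
        h ⟨n, Finset.mem_Iic.2 le_rfl⟩) (measurable_pi_apply _)) with hPν
  have hC₁0 : 0 ≤ C₁ := (abs_nonneg _).trans (hC₁ (Classical.choice (nonempty_of_isProbabilityMeasure ν)))
  -- the past weights `G_t = 1{K_t = j} · (Σ_{u ≤ t} 1{K_u = i} h₁(X_u))²`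
  have hGm : ∀ t, Measurable fun x : ℕ → Ω × Bool =>
      (if (∑ s ∈ Finset.range t, (if (x (s + 1)).2 then (1 : ℕ) else 0)) = j then (1 : ℝ) else 0)
      * (∑ u ∈ Finset.range (t + 1), (if (∑ s ∈ Finset.range u,
        (if (x (s + 1)).2 then (1 : ℕ) else 0)) = i then (1 : ℝ) else 0) * h₁ (x u).1) ^ 2 := fun t =>
    (measurable_headCountIndicator t j).mul ((Finset.measurable_sum _ fun u _ =>
      (measurable_headCountIndicator u i).mul (hh₁.comp (measurable_fst.comp
        (measurable_pi_apply u)))).pow_const 2)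
  have hKdep : ∀ (u t : ℕ), u ≤ t → ∀ (x y : ℕ → Ω × Bool), (∀ n ∈ Set.Iic t, x n = y n) →
      (∑ s ∈ Finset.range u, (if (x (s + 1)).2 then (1 : ℕ) else 0))
        = ∑ s ∈ Finset.range u, (if (y (s + 1)).2 then (1 : ℕ) else 0) := by
    intro u t hut x y hxy
    exact Finset.sum_congr rfl fun s hs => by
      rw [hxy (s + 1) (Set.mem_Iic.2 (by have := Finset.mem_range.1 hs; omega))]
  have hGd : ∀ t, DependsOn (fun x : ℕ → Ω × Bool =>
      (if (∑ s ∈ Finset.range t, (if (x (s + 1)).2 then (1 : ℕ) else 0)) = j then (1 : ℝ) else 0)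
      * (∑ u ∈ Finset.range (t + 1), (if (∑ s ∈ Finset.range u,
        (if (x (s + 1)).2 then (1 : ℕ) else 0)) = i then (1 : ℝ) else 0) * h₁ (x u).1) ^ 2)
      (Set.Iic t) := by
    intro t x y hxy
    show _ * _ = _ * _
    rw [hKdep t t le_rfl x y hxy]
    congr 2
    exact Finset.sum_congr rfl fun u hu => by
      have hut : u ≤ t := by have := Finset.mem_range.1 hu; omega
      rw [hKdep u t hut x y hxy, hxy u (Set.mem_Iic.2 hut)]
  have hsumC : ∀ (t : ℕ) (x : ℕ → Ω × Bool), |∑ u ∈ Finset.range (t + 1), (if (∑ s ∈ Finset.range u,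
      (if (x (s + 1)).2 then (1 : ℕ) else 0)) = i then (1 : ℝ) else 0) * h₁ (x u).1|
      ≤ C₁ * (t + 1) := by
    intro t x
    refine (Finset.abs_sum_le_sum_abs _ _).trans ?_
    calc ∑ u ∈ Finset.range (t + 1), |(if (∑ s ∈ Finset.range u,
          (if (x (s + 1)).2 then (1 : ℕ) else 0)) = i then (1 : ℝ) else 0) * h₁ (x u).1|
        ≤ ∑ u ∈ Finset.range (t + 1), C₁ := Finset.sum_le_sum fun u _ => by
          rw [abs_mul]
          calc _ ≤ 1 * C₁ := mul_le_mul (by split_ifs <;> simp) (hC₁ _) (abs_nonneg _) zero_le_one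
            _ = C₁ := one_mul _
      _ = C₁ * (t + 1) := by
        rw [Finset.sum_const, Finset.card_range, nsmul_eq_mul]; push_cast; ring
  have hGC : ∀ (t : ℕ) (x : ℕ → Ω × Bool),
      |(if (∑ s ∈ Finset.range t, (if (x (s + 1)).2 then (1 : ℕ) else 0)) = j
      then (1 : ℝ) else 0) * (∑ u ∈ Finset.range (t + 1), (if (∑ s ∈ Finset.range u,
        (if (x (s + 1)).2 then (1 : ℕ) else 0)) = i then (1 : ℝ) else 0) * h₁ (x u).1) ^ 2|
      ≤ (C₁ * (t + 1)) ^ 2 := by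
    intro t x
    rw [abs_mul, abs_pow]
    have h1 : |(if (∑ s ∈ Finset.range t, (if (x (s + 1)).2 then (1 : ℕ) else 0)) = j
        then (1 : ℝ) else 0)| ≤ 1 := by split_ifs <;> simp
    calc _ ≤ 1 * (C₁ * (t + 1)) ^ 2 := mul_le_mul h1 (pow_le_pow_left₀ (abs_nonneg _) (hsumC t x) 2)
          (by positivity) zero_le_one
      _ = (C₁ * (t + 1)) ^ 2 := one_mul _
  -- the future functional `(S^{h₂}_0)²`
  have hψ₂ : Measurable fun pq : (Ω × Bool) × (Ω × Bool) => h₂ pq.1.1 :=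
    hh₂.comp (measurable_fst.comp measurable_fst)
  have hHm := (measurable_tourSum (Ω := Ω) (ψ := fun p _ => h₂ p.1) hψ₂ 0).pow_const 2
  have hHi := splitChain_integrable_sq_tourSum κs (ν.map (fun y : Ω => (y, true))) (κ := κ) (ν := ν)
    (hmin := hmin) hε0 hε hκs hh₂ hC₂ 0
  rw [← hPν] at hHi
  -- integrability of the earlier squared tour sum and of `N_i²`
  have hSi := splitChain_integrable_sq_tourSum κs μs (κ := κ) (ν := ν) (hmin := hmin) hε0 hε hκs hh₁
    hC₁ i
  have hNi := splitChain_integrable_sq_tourSum κs μs (κ := κ) (ν := ν) (hmin := hmin) hε0 hε hκs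
    (h := fun _ => (1 : ℝ)) measurable_const (C := 1) (fun _ => by simp) i
  rw [← hP] at hSi hNi
  simp only [mul_one] at hNi
  -- almost surely: the tours end; then the weights pick out `t = τ_{j+1} - 1`
  have hae := splitChain_ae_tourStart κs μs (κ := κ) (ν := ν) (hmin := hmin) hε0 hε hκs
  rw [← hP] at hae
  -- summability of the weights: partial sums `≤ C₁² E[N_i²]`
  have hsum : Summable fun t : ℕ => ∫ x, |(if (∑ s ∈ Finset.range t,
      (if (x (s + 1)).2 then (1 : ℕ) else 0)) = j then (1 : ℝ) else 0)
      * (∑ u ∈ Finset.range (t + 1), (if (∑ s ∈ Finset.range u,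
        (if (x (s + 1)).2 then (1 : ℕ) else 0)) = i then (1 : ℝ) else 0) * h₁ (x u).1) ^ 2|
      * (if (x (t + 1)).2 then (1 : ℝ) else 0) ∂P := by
    have hint : ∀ t, Integrable (fun x : ℕ → Ω × Bool => |(if (∑ s ∈ Finset.range t,
        (if (x (s + 1)).2 then (1 : ℕ) else 0)) = j then (1 : ℝ) else 0)
        * (∑ u ∈ Finset.range (t + 1), (if (∑ s ∈ Finset.range u,
          (if (x (s + 1)).2 then (1 : ℕ) else 0)) = i then (1 : ℝ) else 0) * h₁ (x u).1) ^ 2|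
        * (if (x (t + 1)).2 then (1 : ℝ) else 0)) P := fun t => by
      refine integrable_of_bounded P ((hGm t).abs.mul (measurable_coinHeads (t + 1)))
        (C := (C₁ * (t + 1)) ^ 2 * 1) fun x => ?_
      rw [abs_mul, abs_abs]
      exact mul_le_mul (hGC t x) (by split_ifs <;> simp) (abs_nonneg _) (by positivity)
    refine summable_of_sum_range_le (c := C₁ ^ 2 * ∫ x, (∑' u, (if (∑ s ∈ Finset.range u,
        (if (x (s + 1)).2 then (1 : ℕ) else 0)) = i then (1 : ℝ) else 0)) ^ 2 ∂P)
      (fun t => integral_nonneg fun x => mul_nonneg (abs_nonneg _) (by split_ifs <;> norm_num))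
      fun n => ?_
    rw [← integral_finsetSum _ fun t _ => hint t, ← integral_const_mul]
    refine integral_mono_ae (integrable_finsetSum _ fun t _ => hint t) (hNi.const_mul (C₁ ^ 2)) ?_
    filter_upwards [hae] with x hx
    obtain ⟨t₀, ht₀, hh₀⟩ := hx j
    have hterm : ∀ t, |(if (∑ s ∈ Finset.range t, (if (x (s + 1)).2 then (1 : ℕ) else 0)) = j
        then (1 : ℝ) else 0) * (∑ u ∈ Finset.range (t + 1), (if (∑ s ∈ Finset.range u,
          (if (x (s + 1)).2 then (1 : ℕ) else 0)) = i then (1 : ℝ) else 0) * h₁ (x u).1) ^ 2|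
        * (if (x (t + 1)).2 then (1 : ℝ) else 0)
        ≤ if t = t₀ then C₁ ^ 2 * (∑' u, (if (∑ s ∈ Finset.range u,
          (if (x (s + 1)).2 then (1 : ℕ) else 0)) = i then (1 : ℝ) else 0)) ^ 2 else 0 := by
      intro t
      by_cases h1 : (∑ s ∈ Finset.range t, (if (x (s + 1)).2 then (1 : ℕ) else 0)) = j
      · by_cases h2 : (x (t + 1)).2 = true
        · have ht : t = t₀ := tourStart_unique x h1 h2 ht₀ hh₀
          rw [if_pos ht, if_pos h1, if_pos h2, one_mul, mul_one, ← tourSum_eq_finsetSum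
            (fun p _ => h₁ p.1) x hij h1 h2, abs_pow, ← mul_pow]
          exact pow_le_pow_left₀ (abs_nonneg _)
            (abs_tourSum_le_tourLength (ψ := fun p _ => h₁ p.1) (fun p _ => hC₁ p.1) x hij h1 h2) 2
        · rw [if_neg h2, mul_zero]; split_ifs <;> positivity
      · rw [if_neg h1, zero_mul, abs_zero, zero_mul]; split_ifs <;> positivity
    calc _ ≤ ∑ t ∈ Finset.range n, (if t = t₀ then C₁ ^ 2 * (∑' u, (if (∑ s ∈ Finset.range u,
          (if (x (s + 1)).2 then (1 : ℕ) else 0)) = i then (1 : ℝ) else 0)) ^ 2 else 0) :=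
          Finset.sum_le_sum fun t _ => hterm t
      _ ≤ _ := by
          rw [Finset.sum_ite_eq']
          split_ifs
          · exact le_rfl
          · positivity
  -- the random-time regeneration theorem at `τ_{j+1}` with these weights
  have key := splitChain_regeneration_randomTime κs μs (κ := κ) (ν := ν) (hmin := hmin) hε hκs hGm
    hGd hGC hHm hHi hsum
  have hTi := splitChain_regeneration_randomTime_integrable κs μs (κ := κ) (ν := ν) (hmin := hmin)
    hε hκs hGm hGd hGC hHm hHi hsum
  rw [← hP] at key hTi
  beta_reduce at key hTi
  -- pathwise identifications on the almost sure set where tour `j + 1` starts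
  have hzero : ∀ (x : ℕ → Ω × Bool) (t₀ : ℕ),
      (∑ s ∈ Finset.range t₀, (if (x (s + 1)).2 then (1 : ℕ) else 0)) = j →
      (x (t₀ + 1)).2 = true → ∀ (w : ℕ → ℝ) (t : ℕ), t ≠ t₀ →
      (if (∑ s ∈ Finset.range t, (if (x (s + 1)).2 then (1 : ℕ) else 0)) = j then (1 : ℝ) else 0)
        * (∑ u ∈ Finset.range (t + 1), (if (∑ s ∈ Finset.range u,
          (if (x (s + 1)).2 then (1 : ℕ) else 0)) = i then (1 : ℝ) else 0) * h₁ (x u).1) ^ 2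
        * (if (x (t + 1)).2 then (1 : ℝ) else 0) * w t = 0 := by
    intro x t₀ ht₀ hh₀ w t hne
    by_cases h1 : (∑ s ∈ Finset.range t, (if (x (s + 1)).2 then (1 : ℕ) else 0)) = j
    · have h2 : ¬ (x (t + 1)).2 = true := fun h2 => hne (tourStart_unique x h1 h2 ht₀ hh₀)
      rw [if_neg h2, mul_zero, zero_mul]
    · rw [if_neg h1, zero_mul, zero_mul, zero_mul]
  have hpath : ∀ᵐ x ∂P, (∑' t, (if (∑ s ∈ Finset.range t,
      (if (x (s + 1)).2 then (1 : ℕ) else 0)) = j then (1 : ℝ) else 0)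
      * (∑ u ∈ Finset.range (t + 1), (if (∑ s ∈ Finset.range u,
        (if (x (s + 1)).2 then (1 : ℕ) else 0)) = i then (1 : ℝ) else 0) * h₁ (x u).1) ^ 2
      * (if (x (t + 1)).2 then (1 : ℝ) else 0)
      * (∑' u, (if (∑ s ∈ Finset.range u, (if (x (t + 1 + (s + 1))).2 then (1 : ℕ) else 0)) = 0
        then (1 : ℝ) else 0) * h₂ (x (t + 1 + u)).1) ^ 2)
      = (∑' u, (if (∑ s ∈ Finset.range u, (if (x (s + 1)).2 then (1 : ℕ) else 0)) = i
          then (1 : ℝ) else 0) * h₁ (x u).1) ^ 2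
        * (∑' u, (if (∑ s ∈ Finset.range u, (if (x (s + 1)).2 then (1 : ℕ) else 0)) = j + 1
          then (1 : ℝ) else 0) * h₂ (x u).1) ^ 2 := by
    filter_upwards [hae] with x hx
    obtain ⟨t₀, ht₀, hh₀⟩ := hx j
    have e1 : (∑ u ∈ Finset.range (t₀ + 1), (if (∑ s ∈ Finset.range u,
        (if (x (s + 1)).2 then (1 : ℕ) else 0)) = i then (1 : ℝ) else 0) * h₁ (x u).1)
        = ∑' u, (if (∑ s ∈ Finset.range u, (if (x (s + 1)).2 then (1 : ℕ) else 0)) = i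
          then (1 : ℝ) else 0) * h₁ (x u).1 :=
      (tourSum_eq_finsetSum (fun p _ => h₁ p.1) x hij ht₀ hh₀).symm
    have e2 : (∑' u, (if (∑ s ∈ Finset.range u, (if (x (t₀ + 1 + (s + 1))).2 then (1 : ℕ) else 0))
        = 0 then (1 : ℝ) else 0) * h₂ (x (t₀ + 1 + u)).1)
        = ∑' u, (if (∑ s ∈ Finset.range u, (if (x (s + 1)).2 then (1 : ℕ) else 0)) = j + 1
          then (1 : ℝ) else 0) * h₂ (x u).1 :=
      (tourSum_transport (fun p _ => h₂ p.1) x ht₀ hh₀).symm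
    rw [tsum_eq_single t₀ (hzero x t₀ ht₀ hh₀ _), if_pos ht₀, if_pos hh₀, one_mul, mul_one, e1, e2]
  have hpath' : ∀ᵐ x ∂P, (∑' t, (if (∑ s ∈ Finset.range t,
      (if (x (s + 1)).2 then (1 : ℕ) else 0)) = j then (1 : ℝ) else 0)
      * (∑ u ∈ Finset.range (t + 1), (if (∑ s ∈ Finset.range u,
        (if (x (s + 1)).2 then (1 : ℕ) else 0)) = i then (1 : ℝ) else 0) * h₁ (x u).1) ^ 2
      * (if (x (t + 1)).2 then (1 : ℝ) else 0))
      = (∑' u, (if (∑ s ∈ Finset.range u, (if (x (s + 1)).2 then (1 : ℕ) else 0)) = i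
          then (1 : ℝ) else 0) * h₁ (x u).1) ^ 2 := by
    filter_upwards [hae] with x hx
    obtain ⟨t₀, ht₀, hh₀⟩ := hx j
    have e1 : (∑ u ∈ Finset.range (t₀ + 1), (if (∑ s ∈ Finset.range u,
        (if (x (s + 1)).2 then (1 : ℕ) else 0)) = i then (1 : ℝ) else 0) * h₁ (x u).1)
        = ∑' u, (if (∑ s ∈ Finset.range u, (if (x (s + 1)).2 then (1 : ℕ) else 0)) = i
          then (1 : ℝ) else 0) * h₁ (x u).1 :=
      (tourSum_eq_finsetSum (fun p _ => h₁ p.1) x hij ht₀ hh₀).symm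
    have h0 := hzero x t₀ ht₀ hh₀ (fun _ => 1)
    simp only [mul_one] at h0
    rw [tsum_eq_single t₀ h0, if_pos ht₀, if_pos hh₀, one_mul, mul_one, e1]
  -- `∑' ∫ (weights) = ∫ (S^{h₁}_i)²`
  have hint' : ∀ t, Integrable (fun x : ℕ → Ω × Bool => (if (∑ s ∈ Finset.range t,
      (if (x (s + 1)).2 then (1 : ℕ) else 0)) = j then (1 : ℝ) else 0)
      * (∑ u ∈ Finset.range (t + 1), (if (∑ s ∈ Finset.range u,
        (if (x (s + 1)).2 then (1 : ℕ) else 0)) = i then (1 : ℝ) else 0) * h₁ (x u).1) ^ 2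
      * (if (x (t + 1)).2 then (1 : ℝ) else 0)) P := fun t => by
    refine integrable_of_bounded P ((hGm t).mul (measurable_coinHeads (t + 1)))
      (C := (C₁ * (t + 1)) ^ 2 * 1) fun x => ?_
    rw [abs_mul]
    exact mul_le_mul (hGC t x) (by split_ifs <;> simp) (abs_nonneg _) (by positivity)
  have hsum' : Summable fun t : ℕ => ∫ x, ‖(if (∑ s ∈ Finset.range t,
      (if (x (s + 1)).2 then (1 : ℕ) else 0)) = j then (1 : ℝ) else 0)
      * (∑ u ∈ Finset.range (t + 1), (if (∑ s ∈ Finset.range u,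
        (if (x (s + 1)).2 then (1 : ℕ) else 0)) = i then (1 : ℝ) else 0) * h₁ (x u).1) ^ 2
      * (if (x (t + 1)).2 then (1 : ℝ) else 0)‖ ∂P := by
    refine hsum.congr fun t => integral_congr_ae (ae_of_all _ fun x => ?_)
    beta_reduce
    rw [Real.norm_eq_abs, abs_mul _ (if (x (t + 1)).2 then (1 : ℝ) else 0)]
    congr 1
    exact (abs_of_nonneg (by split_ifs <;> norm_num)).symm
  have hGsum : (∑' t, ∫ x, (if (∑ s ∈ Finset.range t,
      (if (x (s + 1)).2 then (1 : ℕ) else 0)) = j then (1 : ℝ) else 0)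
      * (∑ u ∈ Finset.range (t + 1), (if (∑ s ∈ Finset.range u,
        (if (x (s + 1)).2 then (1 : ℕ) else 0)) = i then (1 : ℝ) else 0) * h₁ (x u).1) ^ 2
      * (if (x (t + 1)).2 then (1 : ℝ) else 0) ∂P)
      = ∫ x, (∑' u, (if (∑ s ∈ Finset.range u, (if (x (s + 1)).2 then (1 : ℕ) else 0)) = i
          then (1 : ℝ) else 0) * h₁ (x u).1) ^ 2 ∂P := by
    rw [integral_tsum_of_summable_integral_norm hint' hsum']
    exact integral_congr_ae hpath'
  refine ⟨hTi.congr hpath, ?_⟩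
  rw [← integral_congr_ae hpath, key, hGsum]

end Covariance

end Summit.Ventures.LatticeQCDFlow.Scoring

end
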